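import Summits.SmoothPoincare4.SmoothPoincare4.Theorems.CylinderEntropyCylinderRungTwoFluxIdentitySides
import HarnessLib

/-!
# Flux identity, part 7: the signed crossing number of a vertical line is `±1`

Part of the proof of the stub `stub_fluxIdentity` (the FLUX IDENTITY `|∫_M ν₅ d(ι^*μH⁴)| = μH⁴(S⁴)`
for connected compact cross-sections of `N = S⁴ × ℝ ⊂ ℝ⁶`) of line `killing-flux` of the crux
`CylinderEntropy.CylinderRungTwo` (stmt-SmoothPoincare4-7631); see the final file
`CylinderEntropyCylinderRungTwoFluxIdentity.lean` for the overall argument. Everything here is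
proved (no named facts); theorems only.

* `low_sub_low_eq_sum` — telescoping count: between two heights off `ι(M)` the change of side
  along the vertical line over `p` is the global jump `d = [a₋] - [a₊]` times the sum of
  `sign ν₅` over the crossings in between;
* `exists_degree` — with the separation hypothesis (no path in `N ∖ ι(M)` from height `≤ -R` to
  height `≥ R`): `d · ∑_{shadow x = p} sign ν₅(x) = 1` for every `p ∈ S⁴` with finite regular
  fibre.
-/

-- the prescribed namespace `Summit.SmoothPoincare4.SmoothPoincare4.…` repeats `SmoothPoincare4`
set_option linter.dupNamespace false

noncomputable section

open MeasureTheory Set Function Filter Module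
open scoped Manifold ContDiff ENNReal Topology RealInnerProductSpace NNReal

namespace Summit.SmoothPoincare4.SmoothPoincare4.Theorems.CylinderRungTwo.KillingFlux

open Literature.Geometry.Riemannian
open Literature.Geometry.Lorentzian Literature.Geometry.Lorentzian.PseudoRiemannianMetric
open Literature.Geometry.Riemannian.SphericalCylinderEntropy (truncL truncL_apply lipschitz_truncL
  hausdorffMeasure_sphere_four_pos hausdorffMeasure_sphere_four_lt_top)
open Literature.Geometry.Manifold.CylinderSlice (axis castSucc_ne_five)

section Normalisation

section Sides

open Literature.Geometry.Manifold.CylinderSlice (padL padL_apply_castSucc padL_apply_last)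

variable {M : Type}

variable [TopologicalSpace M] [ChartedSpace (EuclideanSpace ℝ (Fin 4)) M] [IsManifold (𝓡 4) ∞ M]

/-! ### Counting the crossings of a vertical line -/

/-- A finite set of reals missing `c` stays a positive distance away from `c`. [folklore] -/
theorem exists_pos_forall_lt_abs_sub (G : Finset ℝ) (c : ℝ) (hc : c ∉ G) :
    ∃ δ : ℝ, 0 < δ ∧ ∀ y ∈ G, δ < |y - c| := by
  classical
  induction G using Finset.induction_on with
  | empty => exact ⟨1, one_pos, by simp⟩
  | insert a s ha ih =>
    obtain ⟨δ, hδ, h⟩ := ih fun h => hc (Finset.mem_insert_of_mem h)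
    have hac : a - c ≠ 0 := fun h => hc (by rw [sub_eq_zero.1 h]; exact Finset.mem_insert_self _ _)
    have hpos : 0 < |a - c| := abs_pos.2 hac
    refine ⟨min δ (|a - c| / 2), lt_min hδ (by positivity), fun y hy => ?_⟩
    rcases Finset.mem_insert.1 hy with rfl | hy
    · exact (min_le_right _ _).trans_lt (by linarith)
    · exact (min_le_left _ _).trans_lt (h y hy)

/-- Transport of an `if` along an `iff` of its condition. [folklore] -/
theorem ite_congr_of_iff {P Q : Prop} [Decidable P] [Decidable Q] (h : P ↔ Q) (a b : ℤ) :
    (if P then a else b) = (if Q then a else b) := by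
  rcases Decidable.em Q with hq | hq
  · rw [if_pos hq, if_pos (h.2 hq)]
  · rw [if_neg hq, if_neg (mt h.1 hq)]

open scoped Classical in
/-- **Crossing count along a vertical line (telescoping).** Fix `p ∈ S⁴` whose fibre `F` under
the shadow is finite and regular (`ν₅ ≠ 0` on `F`). For heights `s₀ < s₁` off `ι(M)`, the change
of side between `(p, s₀)` and `(p, s₁)` equals `d · ∑ sign ν₅` over the crossings strictly between,
where `d = [a₋] - [a₊] ∈ {-1, 0, 1}` is the global jump (induction on the number of crossings;
each crossing contributes `d · sign ν₅` by `low_vert_iff_near_crossing`, crossing-free vertical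
segments do not change the side). [folklore] -/
theorem low_sub_low_eq_sum {ι ν : M → (EuclideanSpace ℝ (Fin 6))}
    (hι : Manifold.IsSmoothEmbedding (𝓡 4) (𝓡 6) ∞ ι)
    (hιN : ∀ x, ∑ i : Fin 5, ι x (Fin.castSucc i) ^ 2 = 1)
    (hνn : (euclideanMetric (EuclideanSpace ℝ (Fin 6))).IsUnitNormal (𝓡 4) ι ν 1)
    (hνt : ∀ x, ∑ i : Fin 5, ν x (Fin.castSucc i) * ι x (Fin.castSucc i) = 0) {R t₀ : ℝ}
    {aP aM : Prop}
    (hP : ∀ x, ∀ t ∈ Ioc (0 : ℝ) t₀, (∃ b : EuclideanSpace ℝ (Fin 6), (∑ i : Fin 5, b (Fin.castSucc i) ^ 2 = 1) ∧ b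
          (5 : Fin 6) ≤ -R ∧ JoinedIn (({z : EuclideanSpace ℝ (Fin 6) | ∑ i : Fin 5, z (Fin.castSucc i) ^ 2 = 1} :
          Set (EuclideanSpace ℝ (Fin 6))) \ Set.range ι) ((fun z : EuclideanSpace ℝ (Fin 6) => (‖truncL z‖⁻¹ : ℝ) •
          (z - z (5 : Fin 6) • (axis : EuclideanSpace ℝ (Fin 6))) + z (5 : Fin 6) • (axis : EuclideanSpace ℝ (Fin
          6))) (ι x + t • ν x)) b) ↔ aP)
    (hM : ∀ x, ∀ t ∈ Ioc (0 : ℝ) t₀, (∃ b : EuclideanSpace ℝ (Fin 6), (∑ i : Fin 5, b (Fin.castSucc i) ^ 2 = 1) ∧ b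
          (5 : Fin 6) ≤ -R ∧ JoinedIn (({z : EuclideanSpace ℝ (Fin 6) | ∑ i : Fin 5, z (Fin.castSucc i) ^ 2 = 1} :
          Set (EuclideanSpace ℝ (Fin 6))) \ Set.range ι) ((fun z : EuclideanSpace ℝ (Fin 6) => (‖truncL z‖⁻¹ : ℝ) •
          (z - z (5 : Fin 6) • (axis : EuclideanSpace ℝ (Fin 6))) + z (5 : Fin 6) • (axis : EuclideanSpace ℝ (Fin
          6))) (ι x + t • (-ν x))) b) ↔ aM) (ht₀ : 0 < t₀)
    {p : (EuclideanSpace ℝ (Fin 5))} (hp : ∑ i : Fin 5, p i ^ 2 = 1) {F : Finset M} (hF : ∀ x, x ∈ F ↔ truncL (ι x)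
          = p)
    (hreg : ∀ x ∈ F, ν x 5 ≠ 0) :
    ∀ (k : ℕ) (s₀ s₁ : ℝ), s₀ < s₁ → padL p + s₀ • (axis : (EuclideanSpace ℝ (Fin 6))) ∉ range ι →
      padL p + s₁ • (axis : (EuclideanSpace ℝ (Fin 6))) ∉ range ι →
      (F.filter fun x => s₀ < ι x 5 ∧ ι x 5 < s₁).card = k →
      ((if (∃ b : EuclideanSpace ℝ (Fin 6), (∑ i : Fin 5, b (Fin.castSucc i) ^ 2 = 1) ∧ b (5 : Fin 6) ≤ -R ∧
            JoinedIn (({z : EuclideanSpace ℝ (Fin 6) | ∑ i : Fin 5, z (Fin.castSucc i) ^ 2 = 1} : Set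
            (EuclideanSpace ℝ (Fin 6))) \ Set.range ι) (padL p + s₀ • (axis : (EuclideanSpace ℝ (Fin 6)))) b) then
            (1 : ℤ) else 0) -
        (if (∃ b : EuclideanSpace ℝ (Fin 6), (∑ i : Fin 5, b (Fin.castSucc i) ^ 2 = 1) ∧ b (5 : Fin 6) ≤ -R ∧
              JoinedIn (({z : EuclideanSpace ℝ (Fin 6) | ∑ i : Fin 5, z (Fin.castSucc i) ^ 2 = 1} : Set
              (EuclideanSpace ℝ (Fin 6))) \ Set.range ι) (padL p + s₁ • (axis : (EuclideanSpace ℝ (Fin 6)))) b) then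
              (1 : ℤ) else 0)) =
      ((if aM then (1 : ℤ) else 0) - (if aP then (1 : ℤ) else 0)) *
        ∑ x ∈ F.filter (fun x => s₀ < ι x 5 ∧ ι x 5 < s₁), (if 0 < ν x 5 then (1 : ℤ) else -1) := by
  -- fibre facts
  have hvert : ∀ x ∈ F, ι x = padL p + ι x 5 • (axis : (EuclideanSpace ℝ (Fin 6))) := fun x hx => by
    conv_lhs => rw [eq_vert (ι x), (hF x).1 hx]
  have hinjh : ∀ x ∈ F, ∀ x' ∈ F, ι x 5 = ι x' 5 → x = x' := fun x hx x' hx' h =>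
    hι.isEmbedding.injective (by rw [hvert x hx, hvert x' hx', h])
  have hmemr : ∀ s : ℝ, padL p + s • (axis : (EuclideanSpace ℝ (Fin
        6))) ∈ range ι → ∃ x ∈ F, ι x 5 = s := fun s hs => by
    obtain ⟨x, hxp, hxs⟩ := (vert_mem_range_iff ι p s).1 hs
    exact ⟨x, (hF x).2 hxp, hxs⟩
  intro k
  induction k using Nat.strong_induction_on with
  | _ k IH =>
  intro s₀ s₁ hs h₀ h₁ hcard
  rcases Nat.eq_zero_or_pos k with rfl | hkpos
  · -- no crossing: a free vertical segment
    have hempty := Finset.card_eq_zero.1 hcard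
    have hfree : ∀ s ∈ Set.uIcc s₀ s₁, padL p + s • (axis : (EuclideanSpace ℝ (Fin 6))) ∉ range ι := by
      intro s hsI hsr
      rw [Set.uIcc_of_le hs.le] at hsI
      obtain ⟨x, hxF, hxs⟩ := hmemr s hsr
      rcases hsI.1.eq_or_lt with h | h
      · exact h₀ (h ▸ hsr)
      rcases hsI.2.eq_or_lt with h' | h'
      · exact h₁ (h' ▸ hsr)
      have : x ∈ F.filter fun x => s₀ < ι x 5 ∧ ι x 5 < s₁ :=
        Finset.mem_filter.2 ⟨hxF, hxs ▸ h, hxs ▸ h'⟩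
      rw [hempty] at this
      exact absurd this (Finset.notMem_empty _)
    rw [hempty, Finset.sum_empty, mul_zero, ite_congr_of_iff (low_iff_of_joinedIn (joinedIn_vert hp hfree)),
      sub_self]
  · -- pick a crossing `x⋆` and isolate it
    obtain ⟨xs, hxs⟩ := Finset.card_pos.1 (hcard ▸ hkpos)
    obtain ⟨hxsF, hlo, hhi⟩ := Finset.mem_filter.1 hxs
    set h := ι xs 5 with hh
    -- a gap around the height `h` free of other crossing heights
    set G : Finset ℝ := (F.erase xs).image fun x => ι x 5 with hG
    have hhG : h ∉ G := by
      intro hmem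
      obtain ⟨x, hx, hxh⟩ := Finset.mem_image.1 hmem
      exact (Finset.mem_erase.1 hx).1 (hinjh x (Finset.mem_of_mem_erase hx) xs hxsF hxh)
    obtain ⟨δ₁, hδ₁, hgap⟩ := exists_pos_forall_lt_abs_sub G h hhG
    obtain ⟨δ₀, hδ₀, hcross⟩ := low_vert_iff_near_crossing hι hιN hνn hνt hP hM ht₀ (hreg xs hxsF)
    rw [(hF xs).1 hxsF] at hcross
    set δ : ℝ := min δ₀ (min δ₁ (min ((h - s₀) / 2) ((s₁ - h) / 2))) with hδ
    have hδpos : 0 < δ := lt_min hδ₀ (lt_min hδ₁ (lt_min (by linarith) (by linarith)))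
    have hδ₀' : δ ∈ Ioc (0 : ℝ) δ₀ := ⟨hδpos, min_le_left _ _⟩
    have hδ₁' : δ ≤ δ₁ := (min_le_right _ _).trans (min_le_left _ _)
    have hδs₀ : s₀ < h - δ := by
      have : δ ≤ (h - s₀) / 2 := (min_le_right _ _).trans ((min_le_right _ _).trans (min_le_left _ _))
      linarith
    have hδs₁ : h + δ < s₁ := by
      have : δ ≤ (s₁ - h) / 2 := (min_le_right _ _).trans ((min_le_right _ _).trans (min_le_right _ _))
      linarith
    -- heights within `δ` of `h` belong to `x⋆` only
    have hnear : ∀ x ∈ F, |ι x 5 - h| ≤ δ → x = xs := by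
      intro x hx hxd
      by_contra hne
      have : ι x 5 ∈ G := Finset.mem_image.2 ⟨x, Finset.mem_erase.2 ⟨hne, hx⟩, rfl⟩
      have := hgap _ this
      linarith
    have hfree₁ : padL p + (h - δ) • (axis : (EuclideanSpace ℝ (Fin 6))) ∉ range ι := by
      intro hmem
      obtain ⟨x, hxF, hxh⟩ := hmemr _ hmem
      have := hnear x hxF (by rw [hxh]; simp [abs_of_pos hδpos])
      rw [this] at hxh
      linarith
    have hfree₂ : padL p + (h + δ) • (axis : (EuclideanSpace ℝ (Fin 6))) ∉ range ι := by
      intro hmem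
      obtain ⟨x, hxF, hxh⟩ := hmemr _ hmem
      have := hnear x hxF (by rw [hxh]; simp [abs_of_pos hδpos])
      rw [this] at hxh
      linarith
    -- split the crossings
    set T := F.filter fun x => s₀ < ι x 5 ∧ ι x 5 < s₁ with hT
    set T₁ := F.filter fun x => s₀ < ι x 5 ∧ ι x 5 < h - δ with hT₁
    set T₂ := F.filter fun x => h + δ < ι x 5 ∧ ι x 5 < s₁ with hT₂
    have hsplit : T = T₁ ∪ ({xs} ∪ T₂) := by
      ext x
      simp only [hT, hT₁, hT₂, Finset.mem_union, Finset.mem_filter, Finset.mem_singleton]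
      constructor
      · rintro ⟨hxF, h1, h2⟩
        by_cases hlt : ι x 5 < h - δ
        · exact Or.inl ⟨hxF, h1, hlt⟩
        by_cases hgt : h + δ < ι x 5
        · exact Or.inr (Or.inr ⟨hxF, hgt, h2⟩)
        · refine Or.inr (Or.inl (hnear x hxF ?_))
          rw [abs_le]; constructor <;> linarith
      · rintro (⟨hxF, h1, h2⟩ | rfl | ⟨hxF, h1, h2⟩)
        · exact ⟨hxF, h1, by linarith⟩
        · exact ⟨hxsF, hlo, hhi⟩
        · exact ⟨hxF, by linarith, h2⟩
    have hd₁ : Disjoint T₁ ({xs} ∪ T₂) := by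
      rw [Finset.disjoint_left]
      intro x hx hx'
      obtain ⟨-, -, hx2⟩ := Finset.mem_filter.1 hx
      rcases Finset.mem_union.1 hx' with h' | h'
      · rw [Finset.mem_singleton.1 h'] at hx2; linarith
      · obtain ⟨-, h1, -⟩ := Finset.mem_filter.1 h'; linarith
    have hd₂ : Disjoint ({xs} : Finset M) T₂ := by
      rw [Finset.disjoint_singleton_left]
      intro h'
      obtain ⟨-, h1, -⟩ := Finset.mem_filter.1 h'
      linarith
    have hcardsplit : T.card = T₁.card + (1 + T₂.card) := by
      rw [hsplit, Finset.card_union_of_disjoint hd₁, Finset.card_union_of_disjoint hd₂,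
        Finset.card_singleton]
    have hk₁ : T₁.card < k := by rw [← hcard, hcardsplit]; omega
    have hk₂ : T₂.card < k := by rw [← hcard, hcardsplit]; omega
    have ih₁ := IH _ hk₁ s₀ (h - δ) hδs₀ h₀ hfree₁ rfl
    have ih₂ := IH _ hk₂ (h + δ) s₁ hδs₁ hfree₂ h₁ rfl
    -- the jump at the crossing
    obtain ⟨hup, hdn⟩ := hcross δ hδ₀'
    have hjump : ((if (∃ b : EuclideanSpace ℝ (Fin 6), (∑ i : Fin 5, b (Fin.castSucc i) ^ 2 = 1) ∧ b (5 : Fin 6) ≤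
          -R ∧ JoinedIn (({z : EuclideanSpace ℝ (Fin 6) | ∑ i : Fin 5, z (Fin.castSucc i) ^ 2 = 1} : Set
          (EuclideanSpace ℝ (Fin 6))) \ Set.range ι) (padL p + (h - δ) • (axis : (EuclideanSpace ℝ (Fin 6)))) b)
          then (1 : ℤ) else 0) -
        (if (∃ b : EuclideanSpace ℝ (Fin 6), (∑ i : Fin 5, b (Fin.castSucc i) ^ 2 = 1) ∧ b (5 : Fin 6) ≤ -R ∧
              JoinedIn (({z : EuclideanSpace ℝ (Fin 6) | ∑ i : Fin 5, z (Fin.castSucc i) ^ 2 = 1} : Set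
              (EuclideanSpace ℝ (Fin 6))) \ Set.range ι) (padL p + (h + δ) • (axis : (EuclideanSpace ℝ (Fin 6)))) b)
              then (1 : ℤ) else 0)) =
        ((if aM then (1 : ℤ) else 0) - (if aP then (1 : ℤ) else 0)) *
          (if 0 < ν xs 5 then (1 : ℤ) else -1) := by
      rw [ite_congr_of_iff hdn, ite_congr_of_iff hup]
      by_cases hsgn : 0 < ν xs 5
      · simp only [if_pos hsgn, mul_one]
      · simp only [if_neg hsgn]; ring
    -- assemble
    rw [hsplit, Finset.sum_union hd₁, Finset.sum_union hd₂, Finset.sum_singleton]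
    calc ((if (∃ b : EuclideanSpace ℝ (Fin 6), (∑ i : Fin 5, b (Fin.castSucc i) ^ 2 = 1) ∧ b (5 : Fin 6) ≤ -R ∧
          JoinedIn (({z : EuclideanSpace ℝ (Fin 6) | ∑ i : Fin 5, z (Fin.castSucc i) ^ 2 = 1} : Set (EuclideanSpace
          ℝ (Fin 6))) \ Set.range ι) (padL p + s₀ • (axis : (EuclideanSpace ℝ (Fin 6)))) b) then (1 : ℤ) else 0) -
          (if (∃ b : EuclideanSpace ℝ (Fin 6), (∑ i : Fin 5, b (Fin.castSucc i) ^ 2 = 1) ∧ b (5 : Fin 6) ≤ -R ∧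
                JoinedIn (({z : EuclideanSpace ℝ (Fin 6) | ∑ i : Fin 5, z (Fin.castSucc i) ^ 2 = 1} : Set
                (EuclideanSpace ℝ (Fin 6))) \ Set.range ι) (padL p + s₁ • (axis : (EuclideanSpace ℝ (Fin 6)))) b)
                then (1 : ℤ) else 0))
        = ((if (∃ b : EuclideanSpace ℝ (Fin 6), (∑ i : Fin 5, b (Fin.castSucc i) ^ 2 = 1) ∧ b (5 : Fin 6) ≤ -R ∧
              JoinedIn (({z : EuclideanSpace ℝ (Fin 6) | ∑ i : Fin 5, z (Fin.castSucc i) ^ 2 = 1} : Set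
              (EuclideanSpace ℝ (Fin 6))) \ Set.range ι) (padL p + s₀ • (axis : (EuclideanSpace ℝ (Fin 6)))) b) then
              (1 : ℤ) else 0) -
            (if (∃ b : EuclideanSpace ℝ (Fin 6), (∑ i : Fin 5, b (Fin.castSucc i) ^ 2 = 1) ∧ b (5 : Fin 6) ≤ -R ∧
                  JoinedIn (({z : EuclideanSpace ℝ (Fin 6) | ∑ i : Fin 5, z (Fin.castSucc i) ^ 2 = 1} : Set
                  (EuclideanSpace ℝ (Fin 6))) \ Set.range ι) (padL p + (h - δ) • (axis : (EuclideanSpace ℝ (Fin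
                  6)))) b) then (1 : ℤ) else 0)) +
          ((if (∃ b : EuclideanSpace ℝ (Fin 6), (∑ i : Fin 5, b (Fin.castSucc i) ^ 2 = 1) ∧ b (5 : Fin 6) ≤ -R ∧
                JoinedIn (({z : EuclideanSpace ℝ (Fin 6) | ∑ i : Fin 5, z (Fin.castSucc i) ^ 2 = 1} : Set
                (EuclideanSpace ℝ (Fin 6))) \ Set.range ι) (padL p + (h - δ) • (axis : (EuclideanSpace ℝ (Fin 6))))
                b) then (1 : ℤ) else 0) -
            (if (∃ b : EuclideanSpace ℝ (Fin 6), (∑ i : Fin 5, b (Fin.castSucc i) ^ 2 = 1) ∧ b (5 : Fin 6) ≤ -R ∧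
                  JoinedIn (({z : EuclideanSpace ℝ (Fin 6) | ∑ i : Fin 5, z (Fin.castSucc i) ^ 2 = 1} : Set
                  (EuclideanSpace ℝ (Fin 6))) \ Set.range ι) (padL p + (h + δ) • (axis : (EuclideanSpace ℝ (Fin
                  6)))) b) then (1 : ℤ) else 0)) +
          ((if (∃ b : EuclideanSpace ℝ (Fin 6), (∑ i : Fin 5, b (Fin.castSucc i) ^ 2 = 1) ∧ b (5 : Fin 6) ≤ -R ∧
                JoinedIn (({z : EuclideanSpace ℝ (Fin 6) | ∑ i : Fin 5, z (Fin.castSucc i) ^ 2 = 1} : Set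
                (EuclideanSpace ℝ (Fin 6))) \ Set.range ι) (padL p + (h + δ) • (axis : (EuclideanSpace ℝ (Fin 6))))
                b) then (1 : ℤ) else 0) -
            (if (∃ b : EuclideanSpace ℝ (Fin 6), (∑ i : Fin 5, b (Fin.castSucc i) ^ 2 = 1) ∧ b (5 : Fin 6) ≤ -R ∧
                  JoinedIn (({z : EuclideanSpace ℝ (Fin 6) | ∑ i : Fin 5, z (Fin.castSucc i) ^ 2 = 1} : Set
                  (EuclideanSpace ℝ (Fin 6))) \ Set.range ι) (padL p + s₁ • (axis : (EuclideanSpace ℝ (Fin 6)))) b)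
                  then (1 : ℤ) else 0)) := by ring
      _ = _ := by rw [ih₁, hjump, ih₂]; ring

open scoped Classical in
/-- **The signed crossing number is `±1`.** Under the separation hypothesis there is an integer
`d` (the global jump `[a₋] - [a₊]`) such that for every `p ∈ S⁴` with finite regular fibre `F`,
`d · ∑_{x ∈ F} sign ν₅(x) = 1`: run the telescoping count from far below (lower side, by
definition) to far above (not on the lower side, by the separation hypothesis). [folklore] -/
theorem exists_degree [T2Space M] [CompactSpace M] [ConnectedSpace M] {ι ν : M → (EuclideanSpace ℝ (Fin 6))}
    (hι : Manifold.IsSmoothEmbedding (𝓡 4) (𝓡 6) ∞ ι)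
    (hιN : ∀ x, ∑ i : Fin 5, ι x (Fin.castSucc i) ^ 2 = 1)
    (hνc : Continuous ν) (hνn : (euclideanMetric (EuclideanSpace ℝ (Fin 6))).IsUnitNormal (𝓡 4) ι ν 1)
    (hνt : ∀ x, ∑ i : Fin 5, ν x (Fin.castSucc i) * ι x (Fin.castSucc i) = 0) {R : ℝ}
    (hsep : ∀ a b : (EuclideanSpace ℝ (Fin 6)), ∑ i : Fin 5, a (Fin.castSucc i) ^ 2 = 1 →
      ∑ i : Fin 5, b (Fin.castSucc i) ^ 2 = 1 → a 5 ≤ -R → R ≤ b 5 → ¬ JoinedIn (({z : EuclideanSpace ℝ (Fin 6) | ∑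
            i : Fin 5, z (Fin.castSucc i) ^ 2 = 1} : Set (EuclideanSpace ℝ (Fin 6))) \ range ι) a b) :
    ∃ d : ℤ, ∀ p : (EuclideanSpace ℝ (Fin 5)), ∑ i : Fin 5, p i ^ 2 = 1 → ∀ F : Finset M, (∀ x, x ∈ F ↔ truncL (ι x)
          = p) →
      (∀ x ∈ F, ν x 5 ≠ 0) → d * ∑ x ∈ F, (if 0 < ν x 5 then (1 : ℤ) else -1) = 1 := by
  obtain ⟨t₀, ht₀, aP, aM, hPm, hMm⟩ := exists_side_constants hι hιN hνc hνn hνt R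
  have hP : ∀ x, ∀ t ∈ Ioc (0 : ℝ) t₀, (∃ b : EuclideanSpace ℝ (Fin 6), (∑ i : Fin 5, b (Fin.castSucc i) ^ 2 = 1) ∧
        b (5 : Fin 6) ≤ -R ∧ JoinedIn (({z : EuclideanSpace ℝ (Fin 6) | ∑ i : Fin 5, z (Fin.castSucc i) ^ 2 = 1} :
        Set (EuclideanSpace ℝ (Fin 6))) \ Set.range ι) ((fun z : EuclideanSpace ℝ (Fin 6) => (‖truncL z‖⁻¹ : ℝ) • (z
        - z (5 : Fin 6) • (axis : EuclideanSpace ℝ (Fin 6))) + z (5 : Fin 6) • (axis : EuclideanSpace ℝ (Fin 6))) (ι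
        x + t • ν x)) b) ↔ aP := fun x t ht => (hPm x t ht).2
  have hM : ∀ x, ∀ t ∈ Ioc (0 : ℝ) t₀, (∃ b : EuclideanSpace ℝ (Fin 6), (∑ i : Fin 5, b (Fin.castSucc i) ^ 2 = 1) ∧
        b (5 : Fin 6) ≤ -R ∧ JoinedIn (({z : EuclideanSpace ℝ (Fin 6) | ∑ i : Fin 5, z (Fin.castSucc i) ^ 2 = 1} :
        Set (EuclideanSpace ℝ (Fin 6))) \ Set.range ι) ((fun z : EuclideanSpace ℝ (Fin 6) => (‖truncL z‖⁻¹ : ℝ) • (z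
        - z (5 : Fin 6) • (axis : EuclideanSpace ℝ (Fin 6))) + z (5 : Fin 6) • (axis : EuclideanSpace ℝ (Fin 6))) (ι
        x + t • (-ν x))) b) ↔ aM :=
    fun x t ht => (hMm x t ht).2
  -- a bound on the heights of `ι(M)`
  have hcont : Continuous fun x => |ι x 5| :=
    continuous_abs.comp ((EuclideanSpace.proj (5 : Fin 6)).continuous.comp hι.contMDiff.continuous)
  obtain ⟨B, hB⟩ := (isCompact_range hcont).bddAbove
  have hB' : ∀ x, |ι x 5| ≤ B := fun x => hB ⟨x, rfl⟩
  set R' : ℝ := max R B + 1 with hR'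
  have hBR : B < R' := by rw [hR']; linarith [le_max_right R B]
  have hRR : R ≤ R' := by rw [hR']; linarith [le_max_left R B]
  refine ⟨(if aM then (1 : ℤ) else 0) - (if aP then (1 : ℤ) else 0), fun p hp F hF hreg => ?_⟩
  have hfree : ∀ s : ℝ, B < |s| → padL p + s • (axis : (EuclideanSpace ℝ (Fin 6))) ∉ range ι := by
    intro s hs hmem
    obtain ⟨x, -, hxs⟩ := (vert_mem_range_iff ι p s).1 hmem
    have := hB' x
    rw [hxs] at this
    linarith
  have hB0 : 0 ≤ B := by
    obtain ⟨x₀⟩ := (inferInstance : Nonempty M)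
    exact (abs_nonneg _).trans (hB' x₀)
  have h₀ : padL p + (-R') • (axis : (EuclideanSpace ℝ (Fin
        6))) ∉ range ι := hfree _ (by rw [abs_neg, abs_of_pos]; linarith; linarith)
  have h₁ : padL p + R' • (axis : (EuclideanSpace ℝ (Fin
        6))) ∉ range ι := hfree _ (by rw [abs_of_pos]; linarith; linarith)
  have key := low_sub_low_eq_sum hι hιN hνn hνt hP hM ht₀ hp hF hreg _ (-R') R' (by linarith) h₀ h₁ rfl
  -- all crossings lie between `-R'` and `R'`
  have hall : (F.filter fun x => -R' < ι x 5 ∧ ι x 5 < R') = F := by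
    refine Finset.filter_true_of_mem fun x _ => ?_
    have := hB' x
    rw [abs_le] at this
    constructor <;> linarith
  rw [hall] at key
  -- far below is on the lower side, far above is not
  have hlow : (∃ b : EuclideanSpace ℝ (Fin 6), (∑ i : Fin 5, b (Fin.castSucc i) ^ 2 = 1) ∧ b (5 : Fin 6) ≤ -R ∧
        JoinedIn (({z : EuclideanSpace ℝ (Fin 6) | ∑ i : Fin 5, z (Fin.castSucc i) ^ 2 = 1} : Set (EuclideanSpace ℝ
        (Fin 6))) \ Set.range ι) (padL p + (-R') • (axis : (EuclideanSpace ℝ (Fin 6)))) b) :=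
    low_of_le ⟨vert_mem_Ncyl hp _, h₀⟩ (by rw [vert_apply_five]; linarith)
  have hnot : ¬ (∃ b : EuclideanSpace ℝ (Fin 6), (∑ i : Fin 5, b (Fin.castSucc i) ^ 2 = 1) ∧ b (5 : Fin 6) ≤ -R ∧
        JoinedIn (({z : EuclideanSpace ℝ (Fin 6) | ∑ i : Fin 5, z (Fin.castSucc i) ^ 2 = 1} : Set (EuclideanSpace ℝ
        (Fin 6))) \ Set.range ι) (padL p + R' • (axis : (EuclideanSpace ℝ (Fin 6)))) b) :=
    not_low_of_ge hsep (vert_mem_Ncyl hp _) (by rw [vert_apply_five]; exact hRR)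
  rw [if_pos hlow, if_neg hnot] at key
  linarith

end Sides

end Normalisation

/-- Marker of part 7 (registered sub-goal `stub_fluxIdentity_part7`): a finite set of crossing
heights stays a positive distance from a missing height (`exists_pos_forall_lt_abs_sub`). [folklore] -/
theorem stub_fluxIdentity_part7 :
    ∀ (G : Finset ℝ) (c : ℝ), c ∉ G → ∃ δ : ℝ, 0 < δ ∧ ∀ y ∈ G, δ < |y - c| :=
  fun G c hc => exists_pos_forall_lt_abs_sub G c hc

end Summit.SmoothPoincare4.SmoothPoincare4.Theorems.CylinderRungTwo.KillingFlux
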